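import Summits.ResolutionOfSingularities.ResolutionOfSingularities.Theorems.FrobeniusClosingSteerTranslationTaylor
import Mathlib.Data.Nat.Choose.Sum
import HarnessLib

/-!
# K-β7-hat W2, block δ-prep — the binary TAYLOR COEFFICIENT formula (W4.1, OURS)

For a binary polynomial `Φ ∈ K[Z, W]` and a vector `t = (t₁, t₂)`, the coefficient of `Z^{α₀} W^{α₁}` in
`Φ(Z + t₁, W + t₂)` is `Σ_β Φ_β · C(β₀, α₀) C(β₁, α₁) · t₁^{β₀−α₀} t₂^{β₁−α₁}` (`coeff_transl_eq_sum`; binomial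
theorem). This is the shape in which W2 block β (`…BranchLeadingTerm.main_leading_term`) delivers the
leading coefficients `S_α` along a second branch, and the shape `…TranslationTaylor.transl_eq_self_of_coeff_eq_zero`
consumes. Everything here is OURS, AI-written and AI-checked only; nothing is a statement of [Hironaka2017]. -/

set_option linter.dupNamespace false
set_option autoImplicit false

namespace Summit.ResolutionOfSingularities.ResolutionOfSingularities.Theorems.SwitchingDichotomy.BinaryTaylor

open MvPolynomial
open Summit.ResolutionOfSingularities.ResolutionOfSingularities.Theorems.SwitchingDichotomy.TranslationTaylor
  (monomial_fin_two)

variable {K : Type*} [Field K]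

/-- Binomial expansion of a translated variable as a sum of monomials:
`(X_i + t)^a = Σ_{k ≤ a} C(a, k) t^{a−k} X_i^k`. OURS. -/
theorem X_add_C_pow (i : Fin 2) (t : K) (a : ℕ) :
    ((X i + C t : MvPolynomial (Fin 2) K)) ^ a =
      ∑ k ∈ Finset.range (a + 1), monomial (Finsupp.single i k) ((a.choose k : K) * t ^ (a - k)) := by
  rw [add_pow]
  refine Finset.sum_congr rfl fun k _ => ?_
  rw [X_pow_eq_monomial, ← map_pow, ← map_natCast (C : K →+* MvPolynomial (Fin 2) K)]
  rw [show (monomial (Finsupp.single i k) (1 : K)) * C (t ^ (a - k)) * C (a.choose k : K) =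
      C ((a.choose k : K) * t ^ (a - k)) * monomial (Finsupp.single i k) 1 by rw [map_mul]; ring]
  rw [C_mul_monomial, mul_one]

/-- A monomial of `K[Z, W]` after translation, as a double binomial sum. OURS. -/
theorem transl_monomial_eq_sum (t₁ t₂ : K) (β : Fin 2 →₀ ℕ) (c : K) :
    bind₁ (![X 0 + C t₁, X 1 + C t₂] : Fin 2 → MvPolynomial (Fin 2) K) (monomial β c) =
      ∑ k ∈ Finset.range (β 0 + 1), ∑ l ∈ Finset.range (β 1 + 1),
        monomial (Finsupp.single 0 k + Finsupp.single 1 l)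
          (c * ((β 0).choose k : K) * ((β 1).choose l : K) * t₁ ^ (β 0 - k) * t₂ ^ (β 1 - l)) := by
  rw [monomial_fin_two, map_mul, bind₁_C_right, map_mul, map_pow, map_pow, bind₁_X_right, bind₁_X_right]
  simp only [Matrix.cons_val_zero, Matrix.cons_val_one]
  rw [X_add_C_pow, X_add_C_pow, Finset.sum_mul_sum, Finset.mul_sum]
  refine Finset.sum_congr rfl fun k _ => ?_
  rw [Finset.mul_sum]
  refine Finset.sum_congr rfl fun l _ => ?_
  rw [monomial_mul, C_mul_monomial]
  congr 1
  ring

/-- `single 0 k + single 1 l = α` iff `k = α 0` and `l = α 1`. OURS. -/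
theorem single_add_single_eq_iff (k l : ℕ) (α : Fin 2 →₀ ℕ) :
    Finsupp.single (0 : Fin 2) k + Finsupp.single 1 l = α ↔ k = α 0 ∧ l = α 1 := by
  constructor
  · intro h
    have h0 := DFunLike.congr_fun h 0
    have h1 := DFunLike.congr_fun h 1
    simp at h0 h1
    exact ⟨h0, h1⟩
  · rintro ⟨rfl, rfl⟩
    ext s; fin_cases s <;> simp

/-- **Binary Taylor coefficient formula**: the coefficient of `Z^{α₀} W^{α₁}` in `Φ(Z + t₁, W + t₂)` is
`Σ_{β ∈ supp Φ} Φ_β · C(β₀, α₀) C(β₁, α₁) · t₁^{β₀−α₀} t₂^{β₁−α₁}`. OURS. -/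
theorem coeff_transl_eq_sum (Φ : MvPolynomial (Fin 2) K) (t₁ t₂ : K) (α : Fin 2 →₀ ℕ) :
    coeff α (bind₁ (![X 0 + C t₁, X 1 + C t₂] : Fin 2 → MvPolynomial (Fin 2) K) Φ) =
      ∑ β ∈ Φ.support, coeff β Φ * ((β 0).choose (α 0) : K) * ((β 1).choose (α 1) : K) *
        t₁ ^ (β 0 - α 0) * t₂ ^ (β 1 - α 1) := by
  classical
  conv_lhs => rw [Φ.as_sum]
  rw [map_sum, coeff_sum]
  refine Finset.sum_congr rfl fun β _ => ?_
  rw [transl_monomial_eq_sum, coeff_sum]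
  simp_rw [coeff_sum, coeff_monomial, single_add_single_eq_iff]
  -- collapse the double sum of indicators
  by_cases h0 : α 0 ≤ β 0
  · rw [Finset.sum_eq_single_of_mem (α 0) (Finset.mem_range.mpr (by omega))
      (fun k _ hk => Finset.sum_eq_zero fun l _ => by rw [if_neg (fun h => hk h.1)])]
    by_cases h1 : α 1 ≤ β 1
    · rw [Finset.sum_eq_single_of_mem (α 1) (Finset.mem_range.mpr (by omega))
        (fun l _ hl => by rw [if_neg (fun h => hl h.2)]), if_pos ⟨rfl, rfl⟩]
    · have hz : ∑ l ∈ Finset.range (β 1 + 1),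
          (if α 0 = α 0 ∧ l = α 1 then
            coeff β Φ * ((β 0).choose (α 0) : K) * ((β 1).choose l : K) * t₁ ^ (β 0 - α 0) * t₂ ^ (β 1 - l)
          else 0) = 0 :=
        Finset.sum_eq_zero fun l hl => by
          rw [Finset.mem_range] at hl
          rw [if_neg (fun h => by omega)]
      rw [hz, Nat.choose_eq_zero_of_lt (not_le.mp h1), Nat.cast_zero]
      ring
  · have hz : ∑ k ∈ Finset.range (β 0 + 1), ∑ l ∈ Finset.range (β 1 + 1),
        (if k = α 0 ∧ l = α 1 then
          coeff β Φ * ((β 0).choose k : K) * ((β 1).choose l : K) * t₁ ^ (β 0 - k) * t₂ ^ (β 1 - l)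
        else 0) = 0 :=
      Finset.sum_eq_zero fun k hk => by
        rw [Finset.mem_range] at hk
        exact Finset.sum_eq_zero fun l _ => by rw [if_neg (fun h => by omega)]
    rw [hz, Nat.choose_eq_zero_of_lt (not_le.mp h0), Nat.cast_zero]
    ring

/-- The same over any finite set of exponents containing the support. OURS. -/
theorem coeff_transl_eq_sum_of_subset (Φ : MvPolynomial (Fin 2) K) (t₁ t₂ : K) (α : Fin 2 →₀ ℕ)
    {S : Finset (Fin 2 →₀ ℕ)} (hS : Φ.support ⊆ S) :
    coeff α (bind₁ (![X 0 + C t₁, X 1 + C t₂] : Fin 2 → MvPolynomial (Fin 2) K) Φ) =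
      ∑ β ∈ S, coeff β Φ * ((β 0).choose (α 0) : K) * ((β 1).choose (α 1) : K) *
        t₁ ^ (β 0 - α 0) * t₂ ^ (β 1 - α 1) := by
  rw [coeff_transl_eq_sum]
  exact Finset.sum_subset hS fun β _ hβ => by
    rw [notMem_support_iff.mp hβ]; ring

end Summit.ResolutionOfSingularities.ResolutionOfSingularities.Theorems.SwitchingDichotomy.BinaryTaylor
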